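import Summits.HubbardSuperconductivity.HubbardLadder.Bounds.MottStiffnessCeiling
import Literature.MathematicalPhysics.QuantumLattice.HubbardGroundStateDoublonBound
import HarnessLib

/-!
# Hubbard ladder — Bounds: the ATTRACTIVE (BEC-side) kinetic-energy and stiffness ceilings
# `⟨-T⟩/L² ≤ 40 t²/|U|`, `ρ_s ≤ 10 t²/|U|` (bounds.tex Thm 8, typed AND proved)

HONEST FRAMING (cell pub-hubbard): ladder R1–R4 with certified numbers; no claim on H/H₀. These
are bounds for a MODEL CLASS — the pure square-lattice Hubbard torus `hubbardTorus 2 L 1 U` with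
ATTRACTIVE coupling `U < 0`, even side `L ≥ 4`, EVERY filling `δ ≥ -1`, zero temperature; no
materials claim. Companion text: `pub-hubbard/paper/bounds.tex` §8 (Thm 8); table
`pub-hubbard/pub-hubbard-bounds/BOUNDS.md` row T7 / §2 item 21.

## What is proved (no `sorry`, no new axioms)

The chord (concavity) hook of `StiffnessFromEnergyBrackets.lean` run on the ATTRACTIVE side. For a
unit ground state `ψ` of `H(1,U)`, `U ≤ 0`, in a joint sector `(N, S^z = M)`, and `U < U₁`:
`⟨-T⟩_ψ = U D(ψ) - E(U)` and the chord `E(U₁) ≤ E(U) + (U₁ - U) D(ψ)` give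
`D(ψ) ≥ (L₁ - R)/(U₁ - U)` from brackets `Em ≤ E(U) ≤ R`, `L₁ ≤ E(U₁)`, whence (`U ≤ 0` flips the
sign of the `U D` term)
`⟨-T⟩_ψ = 2(K_x + K_y)(ψ) ≤ (-U)(R - L₁)/(U₁ - U) - Em`
(`two_mul_kinWeight_le_of_energyBrackets_attractive`; hook `StiffnessCeilingFromEnergyBracketsAttractive`,
`@[conjecture] def` PROVED by `…_holds`: `ρ_s L² ≤ ((-U)(R - L₁)/(U₁ - U) - Em)/4` for every flux
stiffness, via the f-sum floor `stiffness_mul_sq_le_sum_re_hop_of_isGroundStateInSector` on `ψ` and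
on `Γ(r)ψ`). The brackets are then supplied IN CLOSED FORM, uniformly in the filling:

* UPPER `E_L(U; 2m, 0) ≤ U m` (`sectorEnergy_two_mul_le_mul`): the fully paired configuration
  `|A↑ ∪ A↓⟩`, `#A = m`, has energy exactly `U m` (`star_single_pairSet_self_hubbardTorus`: the hopping
  term has no diagonal entries, the interaction counts `A`);
* LOWER `E_L(U; 2m, 0) ≥ U m - 8 L²/|U|` for `U < 0`, `L ≥ 3` even
  (`sectorEnergy_two_mul_ge_attractive`): the Langer–Mattis–Kennedy–Lieb bound
  `E ≥ (U/2)N - (U/4)L² - Σ_k √(ε_k² + U²/16)`, valid for EVERY real `U`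
  (`LangerMattis.hubbardTorus_groundEnergyAt_ge`, closed by Jensen in
  `hubbardTorus_groundEnergyAt_ge_lmClosed`), and `√(4 + a²) ≤ a + 2/a` at `a = |U|/4`.

With `U₁ = U/2` the extensive `U m` terms CANCEL and what is left is filling-independent:

* `AttractiveKineticCeiling` (`@[conjecture] def`, PROVED): every unit ground state of every sector
  `(2m, S^z = 0)`, `m ≤ L²`, of `hubbardTorus 2 L 1 U`, `U < 0`, `L ≥ 3` even, has
  `⟨-T⟩_ψ = 2(K_x + K_y)(ψ) ≤ 40 L²/|U|` — the kinetic energy per site of the attractive model is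
  `≤ 40 t²/|U|` at every density (pairs are immobile up to `t²/|U|`);
* `AttractiveStiffnessCeiling` (`@[conjecture] def`, PROVED): every flux stiffness `ρ_s > 0` of the
  `(N_L, S^z = 0)` sector (`N_L = 2⌊(1-δ)L²/2⌋`, any `δ ≥ -1`) obeys **`ρ_s ≤ 10 t²/|U|`**, uniformly in
  `L`; `AttractiveStiffnessCeilingTL` (PROVED) — the same for a stiffness constant valid along all
  large even tori; `AttractiveStiffnessBECLimit` (PROVED) — hence `ρ_s ≤ ε` as soon as `U ≤ -10/ε`
  (the stiffness of the model class vanishes in the BEC limit `U → -∞`, at the rate `t²/|U|`);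
  `AttractiveStiffnessCeilingU40` (PROVED) — the decimal instance `U = -40 t`: `ρ_s ≤ 0.25 t < 4/π²`.

NUMBERS (honest): `10 t²/|U|` is `1.25, 0.625, 0.417, 0.25, 0.1` at `|U| = 8, 16, 24, 40, 100`; it is
below the `U`-independent one-body ceiling `4/π² = 0.4053` (`HalfBathtubStiffnessBound`, half filling)
only for `|U| > 5π²/2 ≈ 24.7 t`, and it does not see the density (the physical BEC stiffness is
`≈ 2 n(1 - n/2) t²/|U|`). Its content is the RIGOROUS `t²/|U|` DECAY on the attractive side for the
whole model class at every filling — the mirror image of the Mott ceiling `≈ 8 t²/U` of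
`MottStiffnessCeiling.lean` (repulsive, half filling only) — obtained with NO numerical input. The
general hook `StiffnessCeilingFromEnergyBracketsAttractive` accepts certified brackets (R1 table,
attractive rows) in place of the closed forms and then improves monotonically with them. It
QUANTIFIES the attractive branch of `KineticWeightMonotoneU.lean` (`kinWeightTT'_le_of_nonpos`:
`U ↦ ⟨-T⟩` is monotone on `U ≤ 0`) by the explicit decay rate `40 L² t²/|U|`, and it supplies the
rigorous `t²/|U|` ceiling that HazraVermaRanderia2019 App. G obtain only approximately (BCS–Leggett
`n(k)`; their exact step-function estimate is `U`-independent).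
References (`lean/references.bib`): LangerMattis1971 eqs. (3)–(5); KennedyLieb1986 Thm 2.1;
KomaTasaki1994 §1 (supergradient); ScalapinoWhiteZhang1993 §II (f-sum floor);
HazraVermaRanderia2019 §III and App. G (the attractive-`U` / BEC discussion of `T_c ≤ D_s`-type
bounds); ParamekantiTrivediRanderia1998 eq. (3); LiebPRL1989 (sector reduction `E(2n) = E(2n, 0)`).
-/

noncomputable section

namespace Summit.HubbardSuperconductivity.HubbardLadder.Bounds

open Matrix Finset Real Filter Topology
open Literature.MathematicalPhysics.QuantumLattice
open Literature.MathematicalPhysics.QuantumFieldTheory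
open Literature.Probability.LatticeModels
open Literature.MathematicalPhysics.QuantumLattice.LangerMattis
open Literature.MathematicalPhysics.QuantumLattice.ThermodynamicLimit
open scoped ComplexOrder ComplexConjugate Topology

variable {L : ℕ} [NeZero L]

/-! ### The attractive chord hook -/

/-- **Upper kinetic bracket, attractive side.** `U ≤ 0`, `U < U₁`, `Em ≤ E(U) ≤ R`, `L₁ ≤ E(U₁)`:
every unit ground state `ψ` of the sector `(N, S^z = M)` of `H(1,U)` has
`⟨-T⟩_ψ = 2(K_x + K_y)(ψ) ≤ (-U)(R - L₁)/(U₁ - U) - Em`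
(`⟨-T⟩ = U D - E`, the chord `D(ψ) ≥ (E(U₁) - E(U))/(U₁ - U)` and `U ≤ 0`). -/
theorem two_mul_kinWeight_le_of_energyBrackets_attractive (hL : 3 ≤ L) {U U₁ : ℝ} (hU : U ≤ 0)
    (hU₁ : U < U₁) {N : ℕ} {M : ℝ} {ψ : Fock (Orb (FermionTorus 2 L))}
    (hgs : IsGroundStateInSector (hubbardTorus 2 L 1 U) N M ψ) (h1 : star ψ ⬝ᵥ ψ = 1)
    {Em R L₁ : ℝ} (hEm : Em ≤ sectorEnergy L U N M) (hR : sectorEnergy L U N M ≤ R)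
    (hL₁ : L₁ ≤ sectorEnergy L U₁ N M) :
    2 * (kinWeightDir 0 ψ + kinWeightDir 1 ψ) ≤ -U * ((R - L₁) / (U₁ - U)) - Em := by
  have hkin : 2 * (kinWeightDir 0 ψ + kinWeightDir 1 ψ) =
      U * doubleOccExp ψ - sectorEnergy L U N M := by
    have h := re_expect_hubbardTorus_eq_kin hL U ψ
    rw [re_expect_eq_sectorEnergy hgs h1] at h
    linarith
  have hch := sectorEnergy_le_add_mul_doubleOccExp hgs h1 U₁
  have hd : 0 < U₁ - U := sub_pos.2 hU₁
  have hD : (L₁ - R) / (U₁ - U) ≤ doubleOccExp ψ := by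
    rw [div_le_iff₀ hd]
    nlinarith [hch, hR, hL₁]
  have hUD := mul_le_mul_of_nonpos_left hD hU
  have hre : U * ((L₁ - R) / (U₁ - U)) = -U * ((R - L₁) / (U₁ - U)) := by ring
  linarith

/-- **Certified-bracket stiffness ceiling, attractive side (PROVED below).** For `L ≥ 3`, `δ ≥ -1`,
`U ≤ 0`, `U < U₁`: if `ρ_s > 0` is a flux stiffness of the `(N_L, S^z = 0)` sector of
`hubbardTorus 2 L 1 U` (`ρ_s θ² ≤ E_L(θ) - E_L(0)` for `|θ| ≤ θ₀`), then for ALL numbers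
`Em ≤ E_L(U; 0) ≤ R` and `L₁ ≤ E_L(U₁; 0)` (certified energy brackets at the two couplings, same torus,
same filling): `ρ_s L² ≤ ((-U)(R - L₁)/(U₁ - U) - Em) / 4`.
kind: support (PROVED below). Why it might fail: it cannot. Sources: KomaTasaki1994 §1;
ScalapinoWhiteZhang1993 §II; HazraVermaRanderia2019 App. G; this cell (bounds.tex Thm 3, Thm 8). -/
@[conjecture] def StiffnessCeilingFromEnergyBracketsAttractive : Prop :=
  ∀ (L : ℕ) [NeZero L], 3 ≤ L → ∀ (U U₁ δ ρs θ₀ : ℝ), -1 ≤ δ → U ≤ 0 → U < U₁ → 0 < ρs → 0 < θ₀ →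
    (∀ θ : ℝ, |θ| ≤ θ₀ → ρs * θ ^ 2 ≤ fluxEnergy L U δ θ - fluxEnergy L U δ 0) →
    ∀ (Em R L₁ : ℝ), Em ≤ fluxEnergy L U δ 0 → fluxEnergy L U δ 0 ≤ R → L₁ ≤ fluxEnergy L U₁ δ 0 →
      ρs * (L : ℝ) ^ 2 ≤ (-U * ((R - L₁) / (U₁ - U)) - Em) / 4

/-- **Proof of `StiffnessCeilingFromEnergyBracketsAttractive`**: f-sum floor on a unit ground state `ψ`
and on `Γ(r)ψ`, `K_y(Γ(r)ψ) = K_x(ψ)`, and the attractive upper kinetic bracket for `Γ(r)ψ`. -/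
theorem stiffnessCeilingFromEnergyBracketsAttractive_holds :
    StiffnessCeilingFromEnergyBracketsAttractive := by
  intro L _ hL U U₁ δ ρs θ₀ hδ hU hU₁ hρs hθ₀ hst Em R L₁ hEm hR hL₁
  obtain ⟨ψ, h1, hgs⟩ := NoGo.exists_unit_groundStateInSector_hubbardTorus L 1 U
    (NoGo.floor_pairNumber_le δ hδ L)
  set φ : Fock (Orb (FermionTorus 2 L)) :=
    fockMapOp (d4Orb (DihedralGroup.r 1 : DihedralGroup 4)) *ᵥ ψ with hφ_def
  have hφgs : IsGroundStateInSector (hubbardTorus 2 L 1 U) (2 * ⌊(1 - δ) * (L : ℝ) ^ 2 / 2⌋₊) 0 φ :=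
    hgs.fockMapOp_d4Orb_mulVec _
  have hφ1 : star φ ⬝ᵥ φ = 1 := by
    rw [hφ_def, star_fockMapOp_mulVec_dotProduct_self _ (d4Orb_bijective _).injective, h1]
  have hKy : kinWeightDir 1 φ = kinWeightDir 0 ψ := kinWeightDir_one_rot ψ
  have hfψ : ρs * (L : ℝ) ^ 2 ≤ kinWeightDir 0 ψ :=
    (stiffness_mul_sq_le_sum_re_hop_of_isGroundStateInSector hL U δ hρs hθ₀ hst hgs h1).trans_eq
      (kinWeightX_eq_kinWeightDir ψ)
  have hfφ : ρs * (L : ℝ) ^ 2 ≤ kinWeightDir 0 φ :=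
    (stiffness_mul_sq_le_sum_re_hop_of_isGroundStateInSector hL U δ hρs hθ₀ hst hφgs hφ1).trans_eq
      (kinWeightX_eq_kinWeightDir φ)
  rw [fluxEnergy_zero_eq_sectorEnergy (L := L) U δ] at hEm hR
  rw [fluxEnergy_zero_eq_sectorEnergy (L := L) U₁ δ] at hL₁
  have hb := two_mul_kinWeight_le_of_energyBrackets_attractive hL hU hU₁ hφgs hφ1 hEm hR hL₁
  rw [hKy] at hb
  linarith

/-! ### Closed-form brackets of the sector `(2m, S^z = 0)` -/

/-- The `(2m, S^z = 0)` sector energy is the `2m`-particle ground energy (`E(2m) = E(2m, 0)`,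
Lieb 1989), `m ≤ L²`. -/
theorem sectorEnergy_two_mul_eq_groundEnergyAt (U : ℝ) {m : ℕ} (hm : m ≤ L ^ 2) :
    sectorEnergy L U (2 * m) 0 = groundEnergyAt (fermionTorusGraph 2 L) 1 U (2 * m) := by
  have hn : m ≤ Fintype.card (FermionTorus 2 L) := by rw [NoGo.card_fermionTorus_two]; exact hm
  rw [groundEnergyAt_eq_minEnergyOn_szSector _ 1 U hn]
  rfl

omit [NeZero L] in
/-- **The energy of the fully paired configuration `|A↑ ∪ A↓⟩` is `U · #A`** (every real `U`): the
hopping part of `hubbardTorus 2 L 1 U` has vanishing diagonal entries and the interaction counts the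
doubly occupied sites `A`. (The attractive atomic-limit ground states; companion of the tree's
`star_single_pairSet_hubbardTorus_eq_zero` for `A ∩ B = ∅`.) -/
theorem star_single_pairSet_self_hubbardTorus (U : ℝ) (A : Finset (FermionTorus 2 L)) :
    (star (Pi.single (pairSet A A) (1 : ℂ)) ⬝ᵥ
      (hubbardTorus 2 L 1 U *ᵥ Pi.single (pairSet A A) 1)).re = U * A.card := by
  rw [Literature.Computability.AlgebraicComplexity.star_single_dotProduct_mulVec_single,
    hubbardTorus_eq_zero_add_smul_interaction U, Matrix.add_apply, Matrix.smul_apply,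
    sum_numberOp_mul_numberOp_eq_diagonal, @Matrix.diagonal_apply_eq _ _ (_)]
  have hd : doublyOccupied (pairSet A A) = A := by
    ext x
    rw [mem_doublyOccupied, orb_zero_mem_pairSet, orb_one_mem_pairSet, and_self_iff]
  have hh : (hubbardTorus 2 L 1 0) (pairSet A A) (pairSet A A) = 0 := by
    unfold hubbardTorus hamiltonian
    simp only [Matrix.add_apply, Matrix.smul_apply, Matrix.sum_apply, Complex.ofReal_zero, zero_smul]
    rw [Finset.sum_eq_zero fun x _ => Finset.sum_eq_zero fun y _ => Finset.sum_eq_zero fun σ _ => ?_]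
    · simp
    · split_ifs with hxy
      · exact creation_mul_annihilation_apply_self_eq_zero
          (fun h => (fermionTorusGraph 2 L).ne_of_adj hxy (orb_inj.1 h).1) _
      · rfl
  rw [hh, hd]
  simp

/-- **Upper bracket `E_L(U; 2m, 0) ≤ U m`** (every real `U`, `m ≤ L²`): the fully paired trial vector
`|A↑ ∪ A↓⟩`, `#A = m`, in the variational principle. -/
theorem sectorEnergy_two_mul_le_mul (U : ℝ) {m : ℕ} (hm : m ≤ L ^ 2) :
    sectorEnergy L U (2 * m) 0 ≤ U * m := by
  classical
  have hcard : m ≤ (Finset.univ : Finset (FermionTorus 2 L)).card := by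
    rw [Finset.card_univ]
    simpa [FermionTorus, Fintype.card_fin] using hm
  obtain ⟨A, -, hA⟩ := Finset.exists_subset_card_eq hcard
  have hmem : (Pi.single (pairSet A A) (1 : ℂ) : Fock (Orb (FermionTorus 2 L))) ∈
      szSector (Λ := FermionTorus 2 L) (2 * m) 0 := by
    rw [mem_szSector_two_mul_zero_iff]
    intro s hs
    by_cases hs0 : s = pairSet A A
    · subst hs0
      exact absurd ⟨by rw [upPart_pairSet, hA], by rw [downPart_pairSet, hA]⟩ hs
    · simp [hs0]
  have h1 : star (Pi.single (pairSet A A) (1 : ℂ) : Fock (Orb (FermionTorus 2 L))) ⬝ᵥ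
      Pi.single (pairSet A A) 1 = 1 :=
    Literature.Computability.AlgebraicComplexity.star_single_dotProduct_single _
  have hH : (hubbardTorus 2 L 1 U).IsHermitian := LiebThm1.hamiltonian_isHermitian _ 1 U
  have hle := minEnergyOn_le_rayleigh_of_mem hH _ hmem h1
  rw [star_single_pairSet_self_hubbardTorus U A, hA] at hle
  exact hle

/-- `√(4 + a²) ≤ a + 2/a` for `a > 0` (square both sides). -/
theorem sqrt_four_add_sq_le {a : ℝ} (ha : 0 < a) : Real.sqrt (4 + a ^ 2) ≤ a + 2 / a := by
  have h0 : 0 ≤ a + 2 / a := by positivity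
  rw [show a + 2 / a = Real.sqrt ((a + 2 / a) ^ 2) from (Real.sqrt_sq h0).symm]
  apply Real.sqrt_le_sqrt
  have h2 : (a + 2 / a) ^ 2 = 4 + a ^ 2 + 4 / a ^ 2 := by
    field_simp
    ring
  rw [h2]
  have : 0 ≤ 4 / a ^ 2 := by positivity
  linarith

/-- **Lower bracket `E_L(U; 2m, 0) ≥ U m - 8 L²/|U|`** for `U < 0`, `L ≥ 3` even, `m ≤ L²`:
Langer–Mattis–Kennedy–Lieb (`E ≥ (U/2)N - (U/4)L² - L²√(4 + U²/16)`, valid for every real `U`) and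
`√(4 + U²/16) ≤ |U|/4 + 8/|U|`. -/
theorem sectorEnergy_two_mul_ge_attractive (hLe : Even L) (hL : 3 ≤ L) {U : ℝ} (hU : U < 0)
    {m : ℕ} (hm : m ≤ L ^ 2) :
    U * m - 8 * (L : ℝ) ^ 2 / (-U) ≤ sectorEnergy L U (2 * m) 0 := by
  rw [sectorEnergy_two_mul_eq_groundEnergyAt U hm]
  have h := hubbardTorus_groundEnergyAt_ge_lmClosed hLe hL U (N := 2 * m) (by omega)
  have hs : Real.sqrt (4 + (U / 4) ^ 2) ≤ -U / 4 + 8 / (-U) := by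
    have h' := sqrt_four_add_sq_le (a := -U / 4) (by linarith)
    have h8 : -U / 4 + 2 / (-U / 4) = -U / 4 + 8 / (-U) := by
      rw [div_div_eq_mul_div]
      ring
    rw [show (-U / 4) ^ 2 = (U / 4) ^ 2 by ring, h8] at h'
    exact h'
  have hL2 : (0 : ℝ) ≤ (L : ℝ) ^ 2 := by positivity
  have hprod : (L : ℝ) ^ 2 * Real.sqrt (4 + (U / 4) ^ 2) ≤
      (L : ℝ) ^ 2 * (-U / 4) + 8 * (L : ℝ) ^ 2 / (-U) := by
    calc (L : ℝ) ^ 2 * Real.sqrt (4 + (U / 4) ^ 2) ≤ (L : ℝ) ^ 2 * (-U / 4 + 8 / (-U)) :=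
        mul_le_mul_of_nonneg_left hs hL2
      _ = (L : ℝ) ^ 2 * (-U / 4) + 8 * (L : ℝ) ^ 2 / (-U) := by ring
  push_cast at h
  linarith

/-! ### Node 1 — the kinetic-energy ceiling `⟨-T⟩ ≤ 40 L²/|U|` (bounds.tex Thm 8(i)) -/

/-- The two closed-form brackets at `U` and the lower one at `U₁ = U/2` in the attractive chord hook:
the extensive `U m` terms cancel. -/
theorem two_mul_kinWeight_le_attractive (hLe : Even L) (hL : 3 ≤ L) {U : ℝ} (hU : U < 0) {m : ℕ}
    (hm : m ≤ L ^ 2) {ψ : Fock (Orb (FermionTorus 2 L))}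
    (hgs : IsGroundStateInSector (hubbardTorus 2 L 1 U) (2 * m) 0 ψ) (h1 : star ψ ⬝ᵥ ψ = 1) :
    2 * (kinWeightDir 0 ψ + kinWeightDir 1 ψ) ≤ 40 * (L : ℝ) ^ 2 / (-U) := by
  have hU2 : U < U / 2 := by linarith
  have hEm := sectorEnergy_two_mul_ge_attractive hLe hL hU hm
  have hR := sectorEnergy_two_mul_le_mul (L := L) U hm
  have hL₁ := sectorEnergy_two_mul_ge_attractive hLe hL (U := U / 2) (by linarith) hm
  have h := two_mul_kinWeight_le_of_energyBrackets_attractive hL hU.le hU2 hgs h1 hEm hR hL₁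
  have hU0 : U ≠ 0 := hU.ne
  have hV : -U ≠ 0 := neg_ne_zero.2 hU0
  have hV2 : -(U / 2) ≠ 0 := by
    intro h'
    apply hU0
    linarith
  have hd : U / 2 - U ≠ 0 := by
    intro h'
    apply hU0
    linarith
  have key : -U * ((U * m - (U / 2 * m - 8 * (L : ℝ) ^ 2 / (-(U / 2)))) / (U / 2 - U)) -
      (U * m - 8 * (L : ℝ) ^ 2 / (-U)) = 40 * (L : ℝ) ^ 2 / (-U) := by
    field_simp
    ring
  linarith

/-- **Thm 8(i) (attractive kinetic-energy ceiling; PROVED below).** `L ≥ 3` even, `U < 0`, `m ≤ L²`: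
every unit ground state `ψ` of `hubbardTorus 2 L 1 U` in the sector `(2m, S^z = 0)` has
`⟨-T⟩_ψ = 2(K_x + K_y)(ψ) ≤ 40 L²/|U|` — kinetic energy per site `≤ 40 t²/|U|` at every density.
kind: support (PROVED). Why it might fail: it cannot; it is informative only for `|U| ≳ 10 t/n`
(the trivial band bound is `⟨-T⟩ ≤ 4 N`). Sources: LangerMattis1971 eqs. (3)–(5); KennedyLieb1986
Thm 2.1; KomaTasaki1994 §1; this cell. -/
@[conjecture] def AttractiveKineticCeiling : Prop :=
  ∀ (L : ℕ) [NeZero L], 3 ≤ L → Even L → ∀ (U : ℝ) (m : ℕ), U < 0 → m ≤ L ^ 2 →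
    ∀ ψ : Fock (Orb (FermionTorus 2 L)), IsGroundStateInSector (hubbardTorus 2 L 1 U) (2 * m) 0 ψ →
      star ψ ⬝ᵥ ψ = 1 → 2 * (kinWeightDir 0 ψ + kinWeightDir 1 ψ) ≤ 40 * (L : ℝ) ^ 2 / (-U)

/-- **Proof of `AttractiveKineticCeiling`.** -/
theorem attractiveKineticCeiling_holds : AttractiveKineticCeiling := by
  intro L _ hL hLe U m hU hm ψ hgs h1
  exact two_mul_kinWeight_le_attractive hLe hL hU hm hgs h1

/-! ### Node 2 — the stiffness ceiling `ρ_s ≤ 10 t²/|U|` (bounds.tex Thm 8(ii)) -/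

/-- **Thm 8(ii) (attractive stiffness ceiling, finite even torus; PROVED below).** `L ≥ 3` even,
`U < 0`, any filling `δ ≥ -1`: every flux stiffness `ρ_s > 0` of the `(N_L, S^z = 0)` sector of
`hubbardTorus 2 L 1 U` (`ρ_s θ² ≤ E_L(θ) - E_L(0)` for `|θ| ≤ θ₀`, `E_L(θ) = fluxEnergy L U δ θ`)
satisfies `ρ_s ≤ 10/|U|` (`t = 1`), uniformly in `L` and `δ`.
kind: support (PROVED). Why it might fail: it cannot; it is below the one-body `4/π²` only for
`|U| > 24.7 t` and does not see the density. Sources: LangerMattis1971; KennedyLieb1986 Thm 2.1;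
ScalapinoWhiteZhang1993 §II; HazraVermaRanderia2019 §III, App. G; this cell. -/
@[conjecture] def AttractiveStiffnessCeiling : Prop :=
  ∀ (L : ℕ) [NeZero L], 3 ≤ L → Even L → ∀ (U δ ρs θ₀ : ℝ), -1 ≤ δ → U < 0 → 0 < ρs → 0 < θ₀ →
    (∀ θ : ℝ, |θ| ≤ θ₀ → ρs * θ ^ 2 ≤ fluxEnergy L U δ θ - fluxEnergy L U δ 0) → ρs ≤ 10 / (-U)

/-- **Proof of `AttractiveStiffnessCeiling`**: f-sum floor on a unit ground state `ψ` and on `Γ(r)ψ`,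
`K_y(Γ(r)ψ) = K_x(ψ)`, and `AttractiveKineticCeiling` for `Γ(r)ψ`: `4 ρ_s L² ≤ 40 L²/|U|`. -/
theorem attractiveStiffnessCeiling_holds : AttractiveStiffnessCeiling := by
  intro L _ hL hLe U δ ρs θ₀ hδ hU hρs hθ₀ hst
  have hm : ⌊(1 - δ) * (L : ℝ) ^ 2 / 2⌋₊ ≤ L ^ 2 := NoGo.floor_pairNumber_le δ hδ L
  obtain ⟨ψ, h1, hgs⟩ := NoGo.exists_unit_groundStateInSector_hubbardTorus L 1 U hm
  set φ : Fock (Orb (FermionTorus 2 L)) :=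
    fockMapOp (d4Orb (DihedralGroup.r 1 : DihedralGroup 4)) *ᵥ ψ with hφ_def
  have hφgs : IsGroundStateInSector (hubbardTorus 2 L 1 U) (2 * ⌊(1 - δ) * (L : ℝ) ^ 2 / 2⌋₊) 0 φ :=
    hgs.fockMapOp_d4Orb_mulVec _
  have hφ1 : star φ ⬝ᵥ φ = 1 := by
    rw [hφ_def, star_fockMapOp_mulVec_dotProduct_self _ (d4Orb_bijective _).injective, h1]
  have hKy : kinWeightDir 1 φ = kinWeightDir 0 ψ := kinWeightDir_one_rot ψ
  have hfψ : ρs * (L : ℝ) ^ 2 ≤ kinWeightDir 0 ψ :=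
    (stiffness_mul_sq_le_sum_re_hop_of_isGroundStateInSector hL U δ hρs hθ₀ hst hgs h1).trans_eq
      (kinWeightX_eq_kinWeightDir ψ)
  have hfφ : ρs * (L : ℝ) ^ 2 ≤ kinWeightDir 0 φ :=
    (stiffness_mul_sq_le_sum_re_hop_of_isGroundStateInSector hL U δ hρs hθ₀ hst hφgs hφ1).trans_eq
      (kinWeightX_eq_kinWeightDir φ)
  have hb := two_mul_kinWeight_le_attractive hLe hL hU hm hφgs hφ1
  rw [hKy] at hb
  have hL2 : (0 : ℝ) < (L : ℝ) ^ 2 := by have := NeZero.pos L; positivity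
  have key : ρs * (L : ℝ) ^ 2 ≤ 10 / (-U) * (L : ℝ) ^ 2 := by
    have : 40 * (L : ℝ) ^ 2 / (-U) = 4 * (10 / (-U) * (L : ℝ) ^ 2) := by ring
    linarith
  exact le_of_mul_le_mul_right key hL2

/-- **BEC limit (PROVED below)**: `L ≥ 3` even, `δ ≥ -1`, `ε > 0`, `U ≤ -10/ε`: every flux stiffness
`ρ_s > 0` of the `(N_L, S^z = 0)` sector of `hubbardTorus 2 L 1 U` satisfies `ρ_s ≤ ε` — the stiffness
of the model class vanishes in the BEC limit `U → -∞`, uniformly in `L` and in the filling.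
kind: support (PROVED). Why it might fail: it cannot. Sources: as Thm 8(ii). -/
@[conjecture] def AttractiveStiffnessBECLimit : Prop :=
  ∀ (L : ℕ) [NeZero L], 3 ≤ L → Even L → ∀ (U δ ρs θ₀ ε : ℝ), -1 ≤ δ → 0 < ε → U ≤ -(10 / ε) →
    0 < ρs → 0 < θ₀ →
    (∀ θ : ℝ, |θ| ≤ θ₀ → ρs * θ ^ 2 ≤ fluxEnergy L U δ θ - fluxEnergy L U δ 0) → ρs ≤ ε

/-- **Proof of `AttractiveStiffnessBECLimit`**: `10/|U| ≤ ε`. -/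
theorem attractiveStiffnessBECLimit_holds : AttractiveStiffnessBECLimit := by
  intro L _ hL hLe U δ ρs θ₀ ε hδ hε hUε hρs hθ₀ hst
  have h10 : 0 < 10 / ε := by positivity
  have hU : U < 0 := by linarith
  have h := attractiveStiffnessCeiling_holds L hL hLe U δ ρs θ₀ hδ hU hρs hθ₀ hst
  have hV : 0 < -U := neg_pos.2 hU
  have hle : 10 / (-U) ≤ ε := by
    rw [div_le_iff₀ hV]
    have h' : 10 / ε ≤ -U := by linarith
    have h'' := (div_le_iff₀ hε).1 h'
    linarith
  exact h.trans hle

/-! ### Node 3 — thermodynamic limit and a decimal instance (bounds.tex Thm 8(iii)) -/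

/-- **Thm 8(iii) (attractive stiffness ceiling, thermodynamic limit; PROVED below).** If `ρ_s > 0` is a
flux stiffness of the `(N_L, S^z = 0)` sectors of `hubbardTorus 2 L 1 U` (`U < 0`, `δ ≥ -1`) for all
large even `L` (same `ρ_s, θ₀`), then `ρ_s ≤ 10/|U|`. kind: support (PROVED; the finite-volume
ceiling is uniform in `L`). Why it might fail: it cannot. Sources: as Thm 8(ii). -/
@[conjecture] def AttractiveStiffnessCeilingTL : Prop :=
  ∀ (U δ ρs θ₀ : ℝ), -1 ≤ δ → U < 0 → 0 < ρs → 0 < θ₀ →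
    (∃ L₀ : ℕ, ∀ (L : ℕ) [NeZero L], L₀ ≤ L → Even L →
      ∀ θ : ℝ, |θ| ≤ θ₀ → ρs * θ ^ 2 ≤ fluxEnergy L U δ θ - fluxEnergy L U δ 0) → ρs ≤ 10 / (-U)

/-- **Proof of `AttractiveStiffnessCeilingTL`**: apply the finite-volume ceiling on the even torus
`L = 2(L₀ + 2) ≥ max(L₀, 4)`. -/
theorem attractiveStiffnessCeilingTL_holds : AttractiveStiffnessCeilingTL := by
  intro U δ ρs θ₀ hδ hU hρs hθ₀ hst
  obtain ⟨L₀, hst⟩ := hst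
  haveI : NeZero (2 * (L₀ + 2)) := ⟨by omega⟩
  exact attractiveStiffnessCeiling_holds (2 * (L₀ + 2)) (by omega) (even_two_mul _) U δ ρs θ₀ hδ hU
    hρs hθ₀ (hst (2 * (L₀ + 2)) (by omega) (even_two_mul _))

/-- **`U = -40 t`: `ρ_s ≤ 0.25 t`** (`< 4/π² = 0.4053`, the `U`-independent one-body ceiling at half
filling) for every flux stiffness of the `(N_L, S^z = 0)` sector of every even torus `L ≥ 4`, every
filling `δ ≥ -1`. kind: support (PROVED). -/
@[conjecture] def AttractiveStiffnessCeilingU40 : Prop :=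
  ∀ (L : ℕ) [NeZero L], 3 ≤ L → Even L → ∀ (δ ρs θ₀ : ℝ), -1 ≤ δ → 0 < ρs → 0 < θ₀ →
    (∀ θ : ℝ, |θ| ≤ θ₀ → ρs * θ ^ 2 ≤ fluxEnergy L (-40) δ θ - fluxEnergy L (-40) δ 0) → ρs ≤ 0.25

/-- **Proof of `AttractiveStiffnessCeilingU40`.** -/
theorem attractiveStiffnessCeilingU40_holds : AttractiveStiffnessCeilingU40 := by
  intro L _ hL hLe δ ρs θ₀ hδ hρs hθ₀ hst
  have h := attractiveStiffnessCeiling_holds L hL hLe (-40) δ ρs θ₀ hδ (by norm_num) hρs hθ₀ hst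
  norm_num at h
  linarith

end Summit.HubbardSuperconductivity.HubbardLadder.Bounds

end
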